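import Literature.AnabelianGeometry.EtaleTheta.Discharge.Sec3Prop34CnstOfRlfQ
import Literature.AnabelianGeometry.EtaleTheta.TemperedFrobenioidToyTorsion
import HarnessLib

/-!
# [EtTh] Thm 3.7 (iii), the `Λ = ℚ` clause: the FAITHFUL ACTION of the image of `Aut_C(A)` in `Aut_{D^cnst}(A^cnst)`
# on `O^×(A)`, read UP TO TORSION — the named predicate `DivisorMonoids.Prop34Cnst₀Torsion` (binder `hQ`, GAP G-w4d084-2)

S. Mochizuki, *The étale theta function and its Frobenioid-theoretic manifestations*, Publ. RIMS **45** (2009)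
[MochizukiEtTh2009], §3, Thm. 3.7 (iii) PDF pp.79–80 (printed 305–306), read on the page: «the natural action of
`Aut_C(A)` on `O^▷(A)` and `O^×(A)` factors through `Aut_{D^cnst}(A^cnst)`.  If, moreover, `Λ ∈ {ℤ, ℚ}`, then this
factorization determines a faithful action of the image of `Aut_C(A)` in `Aut_{D^cnst}(A^cnst)` on `O^▷(A)`, `O^×(A)`»
(v2 doc fix, referee finding F-D13-1: print asserts a FAITHFUL ACTION of the image group, not «the functor
`C → D^cnst` is faithful» as v1's header paraphrased); for `Λ = ℚ` the units are `(O_L^×)^pf = O_L^× ⊗ ℚ`, i.e. the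
action on `O_L^×` is read UP TO TORSION [cite: MochizukiEtTh2009, Thm 3.7 (iii) p.79].  AT THE CONSTRUCTED DATA
(sequel, 2026-08-26): the predicate below holds at `ofGaloisActionConnected` modulo the binder
`GaloisAction.ConstGaloisLawTorsion` (this seat, `Discharge/Sec3Prop34CnstTorsionOfGaloisCovering.lean`, p447930), which
abc-iut-w6-d058 instantiates positively modulo two named `p`-adic inputs and NEGATIVELY at a finite constant field
(`LogDivisorModelConstantFieldGalois` lineage) — the torsion clause needs characteristic-0 local-field input.

abc-iut cell, layer L2; seat abc-iut-L2-t3 (gen 4), OWNER of `DivisorMonoids.Prop34Cnst₀`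
(`TemperedFrobenioidCnst.lean`); 13:00Z v-next census item A3; L2-lead R206 class (c) (a `Prop`-valued
predicate bundle over EXISTING fields: no data field, no instance, no notation; a BINDER OF RECORD, not a
discharge).  The clause is EXACTLY the binder `hQ` of abc-iut-w4-d084's `RealifiedDivisorMonoids.Prop34Cnst.ofRlfQ` /
`TemperedFrobenioid.thm37_iii_withCnst_ofRlfQ` (`Discharge/Sec3Prop34CnstOfRlfQ.lean`, GAP row G-w4d084-2) and of
abc-iut-w5-d164's `thm37_ofRlfQ_of_inputs_of_cosetCnst`; nothing landed is edited.

Why a separate predicate and not a clause of `Prop34Cnst₀`: the typed `Prop34Cnst₀.cnst_map_eq_of_B₀_map_eq`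
states faithfulness of `Y ↦ Y^cnst` on automorphisms acting identically on `Ker(div₀) ≅ O_L^×`; print's `Λ = ℚ`
clause needs the stronger «identically UP TO TORSION», and the two are KERNEL-INDEPENDENT: this seat's
countermodel `TemperedFrobenioidToyTorsion.lean` (p437160: `ToyTorsion.prop34Cnst₀`, `ToyTorsion.not_hQ`) has
`Prop34Cnst₀` true and `hQ` false, torsion in `Ker(div₀)` (print: `μ(L) ⊆ O_L^×`) being the exact obstruction
(`torsionFaithful_of_prop34Cnst₀_of_torsionFree`).  Contents:

* `DivisorMonoids.Prop34Cnst₀Torsion dm cnst` — the predicate (one field, `hQ` verbatim);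
* `Prop34Cnst₀Torsion.cnst_map_eq_of_B₀_map_eq` — it implies the shape of `Prop34Cnst₀`'s faithfulness clause;
  `Prop34Cnst₀Torsion.of_torsionFree` — conversely from `Prop34Cnst₀` when `Ker(div₀)` is torsion-free
  (abc-iut-w4-d084's reduction, re-keyed);
* consumer corollaries BY NAME: `RealifiedDivisorMonoids.Prop34Cnst.ofRlfQ_of_torsion₀`,
  `TemperedFrobenioid.thm37_iii_withCnst_ofRlfQ_of_torsion₀`;
* NV both ways: `Toy.prop34Cnst₀Torsion` (the one-object Prop 3.4 toy, `cnst = 𝟭 (Discrete PUnit)`: holds) and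
  `ToyTorsion.not_prop34Cnst₀Torsion` (p437160's datum: `Prop34Cnst₀` holds, the torsion predicate FAILS) —
  `ToyTorsion.prop34Cnst₀_and_not_prop34Cnst₀Torsion` records the independence on the named predicates.

HONEST FRAMING: a hypothesis structure on OUR typed Def. 3.3 (iii) data (print proves it for the geometric
`B₀`, `F₀` via `Aut(L/K) ↪ Aut(O_L^× ⊗ ℚ)`); nothing here bears on [IUTchIII] Cor. 3.12; typed ≠ proved.
-/

namespace Literature.AnabelianGeometry.EtaleTheta

open CategoryTheory Opposite Literature.AlgebraicGeometry.Frobenioids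

universe u₀ v₀ u₁ v₁ u v w

namespace DivisorMonoids

variable {D₀ : Type u₀} [Category.{v₀} D₀]

/-- **[EtTh] Thm. 3.7 (iii), `Λ = ℚ` clause, at the level of the Def. 3.3 (iii) data**: automorphisms `g, g'`
of `Y ∈ Ob(D₀)` whose pull-back actions on `Ker(B₀(Y) → Φ₀^gp(Y)) ≅ O_L^×` agree UP TO TORSION (for every
unit `b` some positive power of `B₀(g) b` equals the same power of `B₀(g') b`, i.e. they agree on
`(O_L^×)^pf = O_L^× ⊗ ℚ`) have the same image in `Aut_{D^cnst}(Y^cnst)` — "`Aut(L/K)` acts faithfully on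
`(O_L^×)^pf`", the step of the proof of Thm. 3.7 (iii) for `Λ = ℚ` (p.80).  The binder `hQ` of GAP row
G-w4d084-2 verbatim; strictly stronger than `Prop34Cnst₀.cnst_map_eq_of_B₀_map_eq` (kernel-independent:
`ToyTorsion.not_prop34Cnst₀Torsion`). [cite: MochizukiEtTh2009, Thm 3.7 (iii) p.79] -/
structure Prop34Cnst₀Torsion (dm : DivisorMonoids.{u₀, v₀, w} D₀) {Dcnst : Type u₁} [Category.{v₁} Dcnst]
    (cnst : D₀ ⥤ Dcnst) : Prop where
  /-- automorphisms of `Y` acting identically UP TO TORSION on `Ker(B₀(Y) → Φ₀^gp(Y)) ≅ O_L^×` have the same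
  image in `Aut_{D^cnst}(Y^cnst)` -/
  cnst_map_eq_of_B₀_map_pow_eq : ∀ {Y : D₀} (g g' : Y ≅ Y),
    (∀ b : dm.B₀.obj (op Y), dm.div₀ (op Y) b = 1 →
      ∃ N : ℕ+, ((dm.B₀.map g.hom.op).hom b) ^ (N : ℕ) = ((dm.B₀.map g'.hom.op).hom b) ^ (N : ℕ)) →
    cnst.map g.hom = cnst.map g'.hom

namespace Prop34Cnst₀Torsion

variable {dm : DivisorMonoids.{u₀, v₀, w} D₀} {Dcnst : Type u₁} [Category.{v₁} Dcnst] {cnst : D₀ ⥤ Dcnst}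

/-- The torsion clause implies the shape of `Prop34Cnst₀`'s faithfulness clause: automorphisms acting
identically on `Ker(div₀)` act identically up to torsion (exponent `1`). [cite: MochizukiEtTh2009, Thm 3.7 (iii) p.80] -/
theorem cnst_map_eq_of_B₀_map_eq (h : dm.Prop34Cnst₀Torsion cnst) {Y : D₀} (g g' : Y ≅ Y)
    (hb : ∀ b : dm.B₀.obj (op Y), dm.div₀ (op Y) b = 1 →
      (dm.B₀.map g.hom.op).hom b = (dm.B₀.map g'.hom.op).hom b) :
    cnst.map g.hom = cnst.map g'.hom :=
  h.cnst_map_eq_of_B₀_map_pow_eq g g' fun b hdb => ⟨1, by rw [PNat.one_coe, pow_one, pow_one, hb b hdb]⟩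

/-- Conversely, `Prop34Cnst₀` gives the torsion clause when `Ker(div₀)` is TORSION-FREE (every unit `u` with
`div₀ u = 1` and `u ^ N = 1` is `1`) — abc-iut-w4-d084's `torsionFaithful_of_prop34Cnst₀_of_torsionFree` re-keyed
on the named predicate.  (In print `Ker(div₀) = O_L^× ⊇ μ(L)` HAS torsion: this is exactly what separates the
two predicates, cf. `ToyTorsion.not_prop34Cnst₀Torsion`.) [cite: MochizukiEtTh2009, Thm 3.7 (iii) p.80] -/
theorem of_torsionFree (h₀ : dm.Prop34Cnst₀ cnst)
    (htf : ∀ (Y : D₀) (u : dm.B₀.obj (op Y)) (N : ℕ+), dm.div₀ (op Y) u = 1 → u ^ (N : ℕ) = 1 → u = 1) :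
    dm.Prop34Cnst₀Torsion cnst :=
  ⟨fun g g' hb => RealifiedDivisorMonoids.Prop34Cnst.torsionFaithful_of_prop34Cnst₀_of_torsionFree h₀ htf g g' hb⟩

end Prop34Cnst₀Torsion

end DivisorMonoids

/-! ### Consumers re-keyed BY NAME on the predicate -/

namespace RealifiedDivisorMonoids.Prop34Cnst

variable {D₀ : Type u} [Category.{v} D₀] {dm : DivisorMonoids.{u, v, w} D₀}
  {hpf : ∀ Y : D₀ᵒᵖ, IsPerfFactorial (dm.Φ₀.obj Y)} {Dcnst : Type u₁} [Category.{v₁} Dcnst] {cnst : D₀ ⥤ Dcnst}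

/-- **Prop. 3.4 (ii) relative to `D^cnst` for the constructed data of monoid type `ℚ`** (`ofRlfQ dm hpf`) from
the typed `Prop34`, `Prop34Cnst₀` and the named torsion clause — abc-iut-w4-d084's `Prop34Cnst.ofRlfQ` with its
binder `hQ` supplied by `Prop34Cnst₀Torsion`. [cite: MochizukiEtTh2009, Prop 3.4 (ii) p.74] -/
theorem ofRlfQ_of_torsion₀ {V : FrdIMonoidStub.{w}} {V₀ : FrdICatStub.{u, v, w} D₀} (h34 : dm.Prop34 V V₀)
    (h₀ : dm.Prop34Cnst₀ cnst) (hT : dm.Prop34Cnst₀Torsion cnst) :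
    (RealifiedDivisorMonoids.ofRlfQ dm hpf).Prop34Cnst cnst :=
  ofRlfQ h34 h₀ fun g g' hb => hT.cnst_map_eq_of_B₀_map_pow_eq g g' hb

end RealifiedDivisorMonoids.Prop34Cnst

namespace TemperedFrobenioid

variable {D₀ : Type u} [Category.{v} D₀] {dm : DivisorMonoids.{u, v, w} D₀}
  {hpf : ∀ Y : D₀ᵒᵖ, IsPerfFactorial (dm.Φ₀.obj Y)} {V : FrdIMonoidStub.{w}}
  {V₀ : FrdICatStub.{u, v, w} D₀} {D : Type u₀} [Category.{v₀} D] {VD : FrdICatStub.{u₀, v₀, w} D}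
  (C₀ : TemperedFrobenioid (RealifiedDivisorMonoids.ofRlfQ dm hpf) D VD)
  {Dcnst : Type u₁} [Category.{v₁} Dcnst] {cnst : D₀ ⥤ Dcnst}

/-- **[EtTh] Thm. 3.7 (iii) for a tempered Frobenioid of monoid type `ℚ` over the CONSTRUCTED Def. 3.6 (i) data
`ofRlfQ dm hpf`**, modulo the three named predicates on the Def. 3.3 (iii) data: `Prop34`, `Prop34Cnst₀`,
`Prop34Cnst₀Torsion` — abc-iut-w4-d084's `thm37_iii_withCnst_ofRlfQ` with `hQ` supplied by the predicate.
[cite: MochizukiEtTh2009, Thm 3.7 (iii) p.79] -/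
theorem thm37_iii_withCnst_ofRlfQ_of_torsion₀ (F : FrobenioidFacade.{u₀, v₀, w} D) (h34 : dm.Prop34 V V₀)
    (h₀ : dm.Prop34Cnst₀ cnst) (hT : dm.Prop34Cnst₀Torsion cnst) :
    C₀.Thm37_iii (F.withCnst (C₀.base ⋙ cnst)) :=
  C₀.thm37_iii_withCnst_ofRlfQ F h34 h₀ fun g g' hb => hT.cnst_map_eq_of_B₀_map_pow_eq g g' hb

end TemperedFrobenioid

/-! ### Non-vacuity both ways: the predicate holds at the Prop 3.4 toy and FAILS at the torsion countermodel -/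

namespace Toy

/-- At the one-object Prop. 3.4 toy with `cnst := 𝟭 (Discrete PUnit)` the torsion clause holds (all parallel
morphisms of a discrete category are equal) — jointly satisfiable with `Toy.prop34Cnst₀` and the interface stack.
[cite: MochizukiEtTh2009, Thm 3.7 (iii) p.79] -/
theorem prop34Cnst₀Torsion : divisorMonoids.Prop34Cnst₀Torsion (𝟭 (Discrete PUnit.{1})) where
  cnst_map_eq_of_B₀_map_pow_eq _ _ _ := Subsingleton.elim _ _

end Toy

namespace ToyTorsion

/-- **The torsion clause FAILS at the countermodel of `TemperedFrobenioidToyTorsion.lean`** (base `SingleObj ℤ`,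
`B₀ = ℤ × (ℤ/2)²` with the generator swapping the two `ℤ/2`-factors, `cnst = «mod 2»`): `ToyTorsion.not_hQ`
restated on the named predicate. [cite: MochizukiEtTh2009, Thm 3.7 (iii) p.80] -/
theorem not_prop34Cnst₀Torsion : ¬ divisorMonoids.Prop34Cnst₀Torsion cnst :=
  fun h => not_hQ fun g g' hb => h.cnst_map_eq_of_B₀_map_pow_eq g g' hb

/-- **KERNEL INDEPENDENCE on the named predicates**: at the countermodel `Prop34Cnst₀` HOLDS and
`Prop34Cnst₀Torsion` FAILS — the `Λ = ℚ` clause of Thm. 3.7 (iii) is a genuine additional input over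
`Prop34Cnst₀` (torsion in `Ker(div₀)` is the obstruction). [cite: MochizukiEtTh2009, Thm 3.7 (iii) p.80] -/
theorem prop34Cnst₀_and_not_prop34Cnst₀Torsion :
    divisorMonoids.Prop34Cnst₀ cnst ∧ ¬ divisorMonoids.Prop34Cnst₀Torsion cnst :=
  ⟨prop34Cnst₀, not_prop34Cnst₀Torsion⟩

end ToyTorsion

end Literature.AnabelianGeometry.EtaleTheta
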